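import Literature.NumberTheory.LFunctions.ApproxFunctionalEquationUnbalanced
import Literature.NumberTheory.LFunctions.RiemannZetaChiTheta
import Literature.NumberTheory.Sieve.MatomakiRadziwillLemma11Tools
import HarnessLib

/-!
# A self-dual smoothed approximate functional equation on the critical line

Topic `Literature/NumberTheory/LFunctions`. Definitions with bodies and theorems; everything in this
file is PROVED (no named facts).

The Hardy–Littlewood approximate functional equation on the critical line
(Titchmarsh, Theorem 4.13 / (4.12.4): `ζ(s) = ∑_{n≤x} n^{-s} + χ(s) ∑_{n≤y} n^{s-1} + O(x^{-1/2} log t)`,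
`s = 1/2 + it`, `2πxy = t`, `x ≍ y ≍ t^{1/2}`; in the tree with both lengths free in a fixed ratio
range, `Literature.NumberTheory.LFunctions.AFE.approxFunctionalEq_half_chi_unbalanced`) has main
sums of `t`-dependent length. Averaging it over the ratio `x/y = e^{2v}` against a smooth
probability density `φ(v) dv` on `[-κ, κ]` which is EVEN (`φ(-v) = φ(v)`) replaces the sharp
cut-offs by the smooth weights `ρ_n(t) = Φ̄(log n - log x₀(t))`, `x₀(t) = √(t/2π)`,
`Φ̄(u) = ∫_u^∞ φ`, the SAME weight appearing in both sums precisely because `φ` is even: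

  `ζ(1/2+it) = S(t) + χ(1/2+it) S̄(t) + O(t^{-1/4} log t)`,  `S(t) = ∑_n ρ_n(t) n^{-1/2-it}`.

The main part `V = S + χ S̄` is then *self-dual*: `|χ(1/2+it)| = 1` gives `V̄ = χ̄ V` and hence the
pointwise identity `|V|² = 2 Re(V̄ S)`, which converts the mean square of `V` (with its cross terms
`χ̄ S²`) into a correlation of `S` with `V ≈ ζ`, i.e. into a twisted FIRST moment of `ζ`. This is
the device by which the tree proves the lower bound of Radziwiłł's Proposition B
(`Literature/Barriers/RiemannHypothesis/MollifierLimitations*.lean`) without the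
Balasubramanian–Conrey–Heath-Brown asymptotic.

## Main definitions and results (namespace `Literature.NumberTheory.LFunctions.SelfDualAFE`)

* `smoothTransition_one_sub` — Mathlib's smooth step is odd about `1/2`: `σ(1-x) = 1 - σ(x)`.
* `logCutoff κ` (`Φ̄_κ(v) = σ((κ-v)/(2κ))`: smooth, antitone, `= 1` on `v ≤ -κ`, `= 0` on `v ≥ κ`,
  `Φ̄(-v) = 1 - Φ̄(v)`), `logDensity κ = -Φ̄_κ'` (`≥ 0`, even, continuous, total mass `1`,
  vanishing outside `(-κ, κ)`), and the two averaging identities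
  `integral_logDensity_mul_indicator_ge`, `integral_logDensity_mul_indicator_le`
  (`∫ φ(v) 𝟙[u ≤ v] dv = ∫ φ(v) 𝟙[v ≤ -u] dv = Φ̄(u)`).
* `weight κ n t = Φ̄_κ(log n - log √(t/2π))`, `mainSum κ N t = ∑_{n≤N} ρ_n(t) n^{-1/2-it}`,
  `sdAFE κ N t = mainSum + χ(1/2+it) · conj mainSum`.
* `norm_zeta_sub_sdAFE_le` — **the smoothed approximate functional equation**: for
  `0 < κ ≤ 1/6` there are `C, t₀` with `‖ζ(1/2+it) - sdAFE κ N t‖ ≤ C t^{-1/4} log t` for all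
  `t ≥ t₀` and all `N ≥ (6/5)√(t/2π)` (the weights vanish for `n > e^κ √(t/2π)`, so the value does
  not depend on such `N`).
* `norm_riemannZetaChi_half`, `conj_sdAFE`, `normSq_sdAFE` — `‖χ(1/2+it)‖ = 1`, the
  self-duality `V̄ = χ̄ V`, and `‖V‖² = 2 Re(V̄ S)`.
* `cutoffR κ` — the smooth profile `R_κ(x) = Φ̄_κ(−½ log x)` with `ρ_n(t) = R_κ(t/(2πn²))`
  (`weight_eq_cutoffR`), its smoothness, the support of its derivatives, and the bounds
  `‖(d/dt)^j R_κ(t/(2πn²))‖ ≤ B_j/T^j` for `t ≥ T` (`norm_iteratedDeriv_weightProfile_le`), uniformly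
  in `n` — the input for integrating the weights by parts against a smooth window.

## References

* E. C. Titchmarsh, *The Theory of the Riemann Zeta-Function*, 2nd ed. (rev. D. R. Heath-Brown),
  Oxford 1986, Theorem 4.13 and §4.17. [cite: Titchmarsh1986, Theorem 4.13]
* The averaging device and the self-duality identity are folklore (smoothed main sums of
  Riemann–Siegel type); recorded here as the tree's route to [Radziwill2012, Proposition B].
-/

noncomputable section

open Complex MeasureTheory Set Filter intervalIntegral Finset
open scoped Real Topology ComplexConjugate

namespace Literature.NumberTheory.LFunctions.SelfDualAFE

open Literature.NumberTheory.Sieve.MatomakiRadziwillL11 (conj_natCast_cpow)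

/-! ### The smooth step is odd about `1/2` -/

/-- `σ(1 - x) = 1 - σ(x)` for Mathlib's `Real.smoothTransition`
(`σ(x) = e(x)/(e(x) + e(1-x))`). [folklore] -/
theorem smoothTransition_one_sub (x : ℝ) :
    Real.smoothTransition (1 - x) = 1 - Real.smoothTransition x := by
  unfold Real.smoothTransition
  rw [sub_sub_cancel]
  have h := Real.smoothTransition.pos_denom x
  have h' : expNegInvGlue (1 - x) + expNegInvGlue x ≠ 0 := by rw [add_comm]; exact h.ne'
  rw [eq_sub_iff_add_eq, div_add_div _ _ h' h.ne', div_eq_one_iff_eq (mul_ne_zero h' h.ne')]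
  ring

/-! ### The log-symmetric cutoff `Φ̄_κ` -/

/-- The cutoff `Φ̄_κ(v) = σ((κ - v)/(2κ))`: smooth, decreasing from `1` (`v ≤ -κ`) to `0` (`v ≥ κ`),
and odd about `0` in the sense `Φ̄(-v) = 1 - Φ̄(v)`. [folklore] -/
def logCutoff (κ v : ℝ) : ℝ := Real.smoothTransition ((κ - v) / (2 * κ))

/-- Unfolding lemma. [folklore] -/
theorem logCutoff_def (κ v : ℝ) : logCutoff κ v = Real.smoothTransition ((κ - v) / (2 * κ)) := rfl

/-- `Φ̄_κ = 1` on `v ≤ -κ`. [folklore] -/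
theorem logCutoff_eq_one {κ v : ℝ} (hκ : 0 < κ) (hv : v ≤ -κ) : logCutoff κ v = 1 := by
  rw [logCutoff_def]
  apply Real.smoothTransition.one_of_one_le
  rw [le_div_iff₀ (by positivity)]; linarith

/-- `Φ̄_κ = 0` on `v ≥ κ`. [folklore] -/
theorem logCutoff_eq_zero {κ v : ℝ} (hκ : 0 < κ) (hv : κ ≤ v) : logCutoff κ v = 0 := by
  rw [logCutoff_def]
  exact Real.smoothTransition.zero_of_nonpos
    (div_nonpos_of_nonpos_of_nonneg (by linarith) (by positivity))

/-- `0 ≤ Φ̄_κ`. [folklore] -/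
theorem logCutoff_nonneg (κ v : ℝ) : 0 ≤ logCutoff κ v := Real.smoothTransition.nonneg _

/-- `Φ̄_κ ≤ 1`. [folklore] -/
theorem logCutoff_le_one (κ v : ℝ) : logCutoff κ v ≤ 1 := Real.smoothTransition.le_one _

/-- **Log-symmetry**: `Φ̄_κ(-v) = 1 - Φ̄_κ(v)`. [folklore] -/
theorem logCutoff_neg {κ : ℝ} (hκ : κ ≠ 0) (v : ℝ) : logCutoff κ (-v) = 1 - logCutoff κ v := by
  rw [logCutoff_def, logCutoff_def,
    show (κ - -v) / (2 * κ) = 1 - (κ - v) / (2 * κ) by field_simp; ring, smoothTransition_one_sub]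

/-- `Φ̄_κ` is antitone (`κ > 0`). [folklore] -/
theorem logCutoff_antitone {κ : ℝ} (hκ : 0 < κ) : Antitone (logCutoff κ) := fun a b hab =>
  Real.smoothTransition.monotone (div_le_div_of_nonneg_right (by linarith) (by positivity))

/-- `Φ̄_κ` is smooth. [folklore] -/
theorem contDiff_logCutoff (κ : ℝ) {n : ℕ∞} : ContDiff ℝ n (logCutoff κ) :=
  Real.smoothTransition.contDiff.comp ((contDiff_const.sub contDiff_id).div_const _)

/-- `Φ̄_κ` is continuous. [folklore] -/
theorem continuous_logCutoff (κ : ℝ) : Continuous (logCutoff κ) :=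
  (contDiff_logCutoff κ (n := 0)).continuous

/-! ### The density `φ_κ = -Φ̄_κ'` -/

/-- The density `φ_κ(v) = -Φ̄_κ'(v)` (a smooth probability density on `[-κ, κ]`, even). [folklore] -/
def logDensity (κ v : ℝ) : ℝ := -deriv (logCutoff κ) v

/-- Unfolding lemma. [folklore] -/
theorem logDensity_def (κ v : ℝ) : logDensity κ v = -deriv (logCutoff κ) v := rfl

/-- `Φ̄_κ' = -φ_κ`. [folklore] -/
theorem hasDerivAt_logCutoff (κ v : ℝ) : HasDerivAt (logCutoff κ) (-logDensity κ v) v := by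
  rw [logDensity_def, neg_neg]
  exact ((contDiff_logCutoff κ (n := 1)).differentiable (by simp) v).hasDerivAt

/-- `φ_κ` is continuous. [folklore] -/
theorem continuous_logDensity (κ : ℝ) : Continuous (logDensity κ) :=
  ((contDiff_logCutoff κ (n := 1)).continuous_deriv le_rfl).neg

/-- `φ_κ ≥ 0` (`κ > 0`). [folklore] -/
theorem logDensity_nonneg {κ : ℝ} (hκ : 0 < κ) (v : ℝ) : 0 ≤ logDensity κ v := by
  rw [logDensity_def, neg_nonneg]
  exact (logCutoff_antitone hκ).deriv_nonpos

/-- `φ_κ` is even: `φ_κ(-v) = φ_κ(v)`. [folklore] -/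
theorem logDensity_neg {κ : ℝ} (hκ : κ ≠ 0) (v : ℝ) : logDensity κ (-v) = logDensity κ v := by
  -- differentiate `Φ̄(-v) = 1 - Φ̄(v)`
  have h1 : HasDerivAt (fun w => logCutoff κ (-w)) (-logDensity κ (-v) * -1) v :=
    (hasDerivAt_logCutoff κ (-v)).comp v (hasDerivAt_neg v)
  have h2 : HasDerivAt (fun w => logCutoff κ (-w)) (0 - -logDensity κ v) v := by
    have := (hasDerivAt_const v (1 : ℝ)).sub (hasDerivAt_logCutoff κ v)
    refine this.congr_of_eventuallyEq (Filter.Eventually.of_forall fun w => ?_)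
    exact logCutoff_neg hκ w
  have := h1.unique h2
  linarith

/-- `φ_κ = 0` outside `(-κ, κ)` (`κ > 0`): `Φ̄_κ` is locally constant on the open complement,
and `φ_κ` is continuous. [folklore] -/
theorem logDensity_eq_zero {κ v : ℝ} (hκ : 0 < κ) (hv : v ≤ -κ ∨ κ ≤ v) : logDensity κ v = 0 := by
  -- on the open sets `v < -κ`, `v > κ` the cutoff is locally constant
  have hopen1 : ∀ w, w < -κ → logDensity κ w = 0 := by
    intro w hw
    have hev : logCutoff κ =ᶠ[𝓝 w] fun _ => (1 : ℝ) := by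
      filter_upwards [Iio_mem_nhds hw] with u hu
      exact logCutoff_eq_one hκ (le_of_lt hu)
    rw [logDensity_def, hev.deriv_eq, deriv_const, neg_zero]
  have hopen2 : ∀ w, κ < w → logDensity κ w = 0 := by
    intro w hw
    have hev : logCutoff κ =ᶠ[𝓝 w] fun _ => (0 : ℝ) := by
      filter_upwards [Ioi_mem_nhds hw] with u hu
      exact logCutoff_eq_zero hκ (le_of_lt hu)
    rw [logDensity_def, hev.deriv_eq, deriv_const, neg_zero]
  -- the zero set is closed
  have hclosed : IsClosed {w : ℝ | logDensity κ w = 0} :=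
    isClosed_eq (continuous_logDensity κ) continuous_const
  rcases hv with hv | hv
  · have hsub : Set.Iio (-κ) ⊆ {w : ℝ | logDensity κ w = 0} := fun w hw => hopen1 w hw
    have := (hclosed.closure_subset_iff.2 hsub)
    rw [closure_Iio] at this
    exact this hv
  · have hsub : Set.Ioi κ ⊆ {w : ℝ | logDensity κ w = 0} := fun w hw => hopen2 w hw
    have := (hclosed.closure_subset_iff.2 hsub)
    rw [closure_Ioi] at this
    exact this hv

/-- **Fundamental theorem of calculus for `φ_κ`**: `∫_a^b φ_κ = Φ̄_κ(a) - Φ̄_κ(b)`. [folklore] -/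
theorem integral_logDensity (κ a b : ℝ) :
    ∫ v in a..b, logDensity κ v = logCutoff κ a - logCutoff κ b := by
  have h := intervalIntegral.integral_eq_sub_of_hasDerivAt (a := a) (b := b)
    (fun v _ => hasDerivAt_logCutoff κ v) ((continuous_logDensity κ).neg.intervalIntegrable _ _)
  rw [intervalIntegral.integral_neg] at h
  linarith

/-- Total mass: `∫_{-κ'}^{κ'} φ_κ = 1` for `κ' ≥ κ > 0`. [folklore] -/
theorem integral_logDensity_eq_one {κ κ' : ℝ} (hκ : 0 < κ) (hκ' : κ ≤ κ') :
    ∫ v in -κ'..κ', logDensity κ v = 1 := by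
  rw [integral_logDensity, logCutoff_eq_one hκ (by linarith), logCutoff_eq_zero hκ hκ', sub_zero]

/-! ### The two averaging identities -/

/-- The indicator `𝟙[u ≤ v]` as a real function of `v`. [folklore] -/
def indGe (u v : ℝ) : ℝ := if u ≤ v then 1 else 0

/-- The indicator `𝟙[v ≤ w]` as a real function of `v`. [folklore] -/
def indLe (w v : ℝ) : ℝ := if v ≤ w then 1 else 0

/-- [folklore] -/
theorem indGe_apply (u v : ℝ) : indGe u v = if u ≤ v then 1 else 0 := rfl

/-- [folklore] -/
theorem indLe_apply (w v : ℝ) : indLe w v = if v ≤ w then 1 else 0 := rfl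

/-- `v ↦ 𝟙[u ≤ v]` is monotone, hence measurable. [folklore] -/
theorem monotone_indGe (u : ℝ) : Monotone (indGe u) := by
  intro a b hab
  simp only [indGe_apply]
  by_cases h1 : u ≤ a
  · rw [if_pos h1, if_pos (h1.trans hab)]
  · rw [if_neg h1]; split_ifs <;> norm_num

/-- `v ↦ 𝟙[v ≤ w]` is antitone, hence measurable. [folklore] -/
theorem antitone_indLe (w : ℝ) : Antitone (indLe w) := by
  intro a b hab
  simp only [indLe_apply]
  by_cases h1 : b ≤ w
  · rw [if_pos h1, if_pos (hab.trans h1)]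
  · rw [if_neg h1]; split_ifs <;> norm_num

/-- [folklore] -/
theorem measurable_indGe (u : ℝ) : Measurable (indGe u) := (monotone_indGe u).measurable

/-- [folklore] -/
theorem measurable_indLe (w : ℝ) : Measurable (indLe w) := (antitone_indLe w).measurable

/-- [folklore] -/
theorem abs_indGe_le_one (u v : ℝ) : |indGe u v| ≤ 1 := by
  rw [indGe_apply]; split_ifs <;> simp

/-- [folklore] -/
theorem abs_indLe_le_one (w v : ℝ) : |indLe w v| ≤ 1 := by
  rw [indLe_apply]; split_ifs <;> simp

/-- A continuous function times a bounded measurable one is interval integrable. [folklore] -/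
theorem intervalIntegrable_continuous_mul {f g : ℝ → ℝ} (hf : Continuous f) (hg : Measurable g)
    (hg1 : ∀ v, |g v| ≤ 1) (a b : ℝ) : IntervalIntegrable (fun v => f v * g v) volume a b := by
  -- `|f g| ≤ |f|`, and `f` is interval integrable
  refine (hf.intervalIntegrable a b).norm.mono_fun' ?_ ?_
  · exact (hf.aestronglyMeasurable.mul hg.aestronglyMeasurable).restrict
  · refine Filter.Eventually.of_forall fun v => ?_
    show ‖f v * g v‖ ≤ ‖f v‖
    rw [Real.norm_eq_abs, Real.norm_eq_abs, abs_mul]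
    exact mul_le_of_le_one_right (abs_nonneg _) (hg1 v)

/-- **First averaging identity**: `∫_{-κ}^{κ} φ_κ(v) 𝟙[u ≤ v] dv = Φ̄_κ(u)`. [folklore] -/
theorem integral_logDensity_mul_indGe {κ : ℝ} (hκ : 0 < κ) (u : ℝ) :
    ∫ v in -κ..κ, logDensity κ v * indGe u v = logCutoff κ u := by
  -- the clamped point `u' ∈ [-κ, κ]` with `Φ̄(u') = Φ̄(u)`
  set u' : ℝ := max (-κ) (min u κ) with hu'
  have hu'1 : -κ ≤ u' := le_max_left _ _
  have hu'2 : u' ≤ κ := max_le (by linarith) (min_le_right _ _)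
  have hΦ : logCutoff κ u' = logCutoff κ u := by
    rcases le_total u (-κ) with h | h
    · have : u' = -κ := by
        rw [hu', max_eq_left]; exact le_trans (min_le_left _ _) h
      rw [this, logCutoff_eq_one hκ le_rfl, logCutoff_eq_one hκ h]
    · rcases le_total u κ with h' | h'
      · have : u' = u := by rw [hu', min_eq_left h', max_eq_right h]
        rw [this]
      · have : u' = κ := by rw [hu', min_eq_right h', max_eq_right (by linarith)]
        rw [this, logCutoff_eq_zero hκ le_rfl, logCutoff_eq_zero hκ h']
  have hint : ∀ a b : ℝ, IntervalIntegrable (fun v => logDensity κ v * indGe u v) volume a b :=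
    intervalIntegrable_continuous_mul (continuous_logDensity κ) (measurable_indGe u)
      (abs_indGe_le_one u)
  rw [← intervalIntegral.integral_add_adjacent_intervals (hint (-κ) u') (hint u' κ)]
  -- on `(-κ, u')` the integrand vanishes (a.e.: except possibly at `v = u`)
  have h1 : ∫ v in -κ..u', logDensity κ v * indGe u v = 0 := by
    rw [← intervalIntegral.integral_zero (a := -κ) (b := u')]
    refine intervalIntegral.integral_congr_ae ?_
    have hae : ∀ᵐ v ∂(volume : Measure ℝ), v ≠ u := ae_iff.2 (by simp)
    filter_upwards [hae] with v hv hmem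
    rw [Set.uIoc_of_le hu'1] at hmem
    -- `v ≤ u'` and `v ≠ u`: if `u ≤ v` then `u ≤ v ≤ u' ≤ min u κ ≤ u` forces `v = u` unless `u' = -κ`
    rw [indGe_apply]
    split_ifs with h
    · exfalso
      have hv2 : v ≤ u' := hmem.2
      rcases le_total u (-κ) with hh | hh
      · -- `u ≤ -κ < v` ... then `u' = -κ`, `v ≤ -κ`, contradiction with `-κ < v`
        have : u' = -κ := by rw [hu', max_eq_left]; exact le_trans (min_le_left _ _) hh
        linarith [hmem.1]
      · have : u' ≤ u := le_trans (max_le (by linarith) (min_le_left _ _)) le_rfl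
        exact hv (le_antisymm (hv2.trans this) h)
    · simp
  -- on `(u', κ)` the integrand is `φ` (a.e.: except possibly at `v = u'`)
  have h2 : ∫ v in u'..κ, logDensity κ v * indGe u v = ∫ v in u'..κ, logDensity κ v := by
    refine intervalIntegral.integral_congr_ae ?_
    refine Filter.Eventually.of_forall fun v hmem => ?_
    rw [Set.uIoc_of_le hu'2] at hmem
    rw [indGe_apply, if_pos, mul_one]
    -- `u' < v`; show `u ≤ v`
    rcases le_total u κ with hh | hh
    · have : min u κ = u := min_eq_left hh
      have : u ≤ u' := by rw [hu', this]; exact le_max_right _ _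
      linarith [hmem.1]
    · -- `u ≥ κ`: then `u' = κ` and `v ≤ κ < v` impossible unless...: here `hmem : u' < v ≤ κ`
      have : u' = κ := by rw [hu', min_eq_right hh, max_eq_right (by linarith)]
      linarith [hmem.1, hmem.2]
  rw [h1, h2, zero_add, integral_logDensity, logCutoff_eq_zero hκ le_rfl, sub_zero, hΦ]

/-- **Second averaging identity**: `∫_{-κ}^{κ} φ_κ(v) 𝟙[v ≤ -u] dv = Φ̄_κ(u)` — by the evenness of
`φ_κ` (equivalently `Φ̄(-v) = 1 - Φ̄(v)`), the reflected range carries the same weight. [folklore] -/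
theorem integral_logDensity_mul_indLe {κ : ℝ} (hκ : 0 < κ) (u : ℝ) :
    ∫ v in -κ..κ, logDensity κ v * indLe (-u) v = logCutoff κ u := by
  -- substitute `v ↦ -v` and use evenness
  have h1 : ∫ v in -κ..κ, logDensity κ v * indLe (-u) v
      = ∫ v in -κ..κ, logDensity κ (-v) * indLe (-u) (-v) := by
    rw [intervalIntegral.integral_comp_neg (fun v => logDensity κ v * indLe (-u) v)]
    simp
  rw [h1]
  have h2 : ∀ v, logDensity κ (-v) * indLe (-u) (-v) = logDensity κ v * indGe u v := by
    intro v
    rw [logDensity_neg hκ.ne', indLe_apply, indGe_apply]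
    congr 1
    simp only [neg_le_neg_iff]
  simp_rw [h2]
  exact integral_logDensity_mul_indGe hκ u

/-! ### The smoothed main sum and the self-dual main part -/

/-- The weights `ρ_n(t) = Φ̄_κ(log n - log √(t/2π))` (`= 1` for `n ≤ e^{-κ}√(t/2π)`, `= 0` for
`n ≥ e^{κ}√(t/2π)`). [folklore] -/
def weight (κ : ℝ) (n : ℕ) (t : ℝ) : ℝ :=
  logCutoff κ (Real.log n - Real.log (Real.sqrt (t / (2 * π))))

/-- Unfolding lemma. [folklore] -/
theorem weight_def (κ : ℝ) (n : ℕ) (t : ℝ) :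
    weight κ n t = logCutoff κ (Real.log n - Real.log (Real.sqrt (t / (2 * π)))) := rfl

/-- `0 ≤ ρ_n ≤ 1`. [folklore] -/
theorem weight_mem_Icc (κ : ℝ) (n : ℕ) (t : ℝ) : weight κ n t ∈ Set.Icc (0 : ℝ) 1 :=
  ⟨logCutoff_nonneg _ _, logCutoff_le_one _ _⟩

/-- `ρ_n(t) = 0` for `n ≥ e^κ √(t/2π)` (`κ > 0`, `t > 0`). [folklore] -/
theorem weight_eq_zero {κ : ℝ} (hκ : 0 < κ) {n : ℕ} {t : ℝ} (ht : 0 < t)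
    (hn : Real.exp κ * Real.sqrt (t / (2 * π)) ≤ n) : weight κ n t = 0 := by
  have hx₀ : 0 < Real.sqrt (t / (2 * π)) := Real.sqrt_pos.2 (by positivity)
  have hnpos : (0 : ℝ) < n := lt_of_lt_of_le (by positivity) hn
  apply logCutoff_eq_zero hκ
  rw [le_sub_iff_add_le, ← Real.log_exp κ, ← Real.log_mul (Real.exp_pos κ).ne' hx₀.ne']
  exact Real.log_le_log (by positivity) hn

/-- `ρ_n(t) = 1` for `1 ≤ n ≤ e^{-κ} √(t/2π)` (`κ > 0`, `t > 0`). [folklore] -/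
theorem weight_eq_one {κ : ℝ} (hκ : 0 < κ) {n : ℕ} {t : ℝ} (ht : 0 < t) (hn1 : 1 ≤ n)
    (hn : (n : ℝ) ≤ Real.exp (-κ) * Real.sqrt (t / (2 * π))) : weight κ n t = 1 := by
  have hnpos : (0 : ℝ) < n := by exact_mod_cast hn1
  have hx₀ : 0 < Real.sqrt (t / (2 * π)) := Real.sqrt_pos.2 (by positivity)
  apply logCutoff_eq_one hκ
  have := Real.log_le_log hnpos hn
  rw [Real.log_mul (Real.exp_pos _).ne' hx₀.ne', Real.log_exp] at this
  linarith

/-- The smoothed main sum `S(t) = ∑_{n ≤ N} ρ_n(t) n^{-1/2-it}`. [folklore] -/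
def mainSum (κ : ℝ) (N : ℕ) (t : ℝ) : ℂ :=
  ∑ n ∈ Finset.Icc 1 N, (weight κ n t : ℂ) * (n : ℂ) ^ (-(1 / 2 : ℂ) - t * I)

/-- Unfolding lemma. [folklore] -/
theorem mainSum_def (κ : ℝ) (N : ℕ) (t : ℝ) :
    mainSum κ N t = ∑ n ∈ Finset.Icc 1 N, (weight κ n t : ℂ) * (n : ℂ) ^ (-(1 / 2 : ℂ) - t * I) :=
  rfl

/-- `conj S(t) = ∑_{n ≤ N} ρ_n(t) n^{-1/2+it}` (the weights are real). [folklore] -/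
theorem conj_mainSum (κ : ℝ) (N : ℕ) (t : ℝ) :
    conj (mainSum κ N t) = ∑ n ∈ Finset.Icc 1 N, (weight κ n t : ℂ) * (n : ℂ) ^ (-(1 / 2 : ℂ) + t * I) := by
  rw [mainSum_def, map_sum]
  refine Finset.sum_congr rfl fun n _ => ?_
  rw [map_mul, Complex.conj_ofReal, conj_natCast_cpow]
  congr 2
  apply Complex.ext <;> simp

/-- The **self-dual smoothed main part** `V(t) = S(t) + χ(1/2+it) conj S(t)`. [folklore] -/
def sdAFE (κ : ℝ) (N : ℕ) (t : ℝ) : ℂ :=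
  mainSum κ N t + Literature.NumberTheory.LFunctions.riemannZetaChi (1 / 2 + t * I) * conj (mainSum κ N t)

/-- Unfolding lemma. [folklore] -/
theorem sdAFE_def (κ : ℝ) (N : ℕ) (t : ℝ) :
    sdAFE κ N t = mainSum κ N t
      + Literature.NumberTheory.LFunctions.riemannZetaChi (1 / 2 + t * I) * conj (mainSum κ N t) := rfl

/-! ### Averaging the unbalanced approximate functional equation -/

/-- `e^{1/6} ≤ 6/5`. [folklore] -/
theorem exp_one_sixth_le : Real.exp (1 / 6) ≤ 6 / 5 := by
  have h : Real.exp (1 / 6) ^ 6 ≤ (6 / 5 : ℝ) ^ 6 := by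
    rw [← Real.exp_nat_mul]; norm_num
    have := Real.exp_one_lt_d9; linarith
  exact le_of_pow_le_pow_left₀ (by norm_num) (by norm_num) h

/-- A sharp sum over `n ≤ ⌊z⌋` as a sum over a fixed range with the indicator `𝟙[log n - c ≤ v]`,
when `z = e^{v} e^{c}`: for `1 ≤ n`, `n ≤ z ↔ log n - c ≤ v`. [folklore] -/
theorem sum_floor_eq_sum_indGe {N : ℕ} {c v : ℝ} (hN : Real.exp v * Real.exp c ≤ N)
    (f : ℕ → ℂ) :
    ∑ n ∈ Finset.Icc 1 ⌊Real.exp v * Real.exp c⌋₊, f n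
      = ∑ n ∈ Finset.Icc 1 N, ((indGe (Real.log n - c) v : ℝ) : ℂ) * f n := by
  have hz : 0 < Real.exp v * Real.exp c := by positivity
  rw [← Finset.sum_filter_add_sum_filter_not (Finset.Icc 1 N) (fun n : ℕ => (n : ℝ) ≤ Real.exp v * Real.exp c)]
  have hzero : ∑ n ∈ Finset.filter (fun n : ℕ => ¬ (n : ℝ) ≤ Real.exp v * Real.exp c) (Finset.Icc 1 N),
      ((indGe (Real.log n - c) v : ℝ) : ℂ) * f n = 0 := by
    refine Finset.sum_eq_zero fun n hn => ?_
    rw [Finset.mem_filter] at hn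
    have hn1 : (1 : ℝ) ≤ n := by exact_mod_cast (Finset.mem_Icc.1 hn.1).1
    have hlt : Real.exp v * Real.exp c < n := lt_of_not_ge hn.2
    have : ¬ (Real.log n - c ≤ v) := by
      intro h
      have h' : Real.log n ≤ v + c := by linarith
      have := Real.exp_le_exp.2 h'
      rw [Real.exp_log (by linarith), Real.exp_add] at this
      linarith
    rw [indGe_apply, if_neg this]; simp
  rw [hzero, add_zero]
  have hfilter : Finset.filter (fun n : ℕ => (n : ℝ) ≤ Real.exp v * Real.exp c) (Finset.Icc 1 N)
      = Finset.Icc 1 ⌊Real.exp v * Real.exp c⌋₊ := by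
    ext n
    simp only [Finset.mem_filter, Finset.mem_Icc]
    constructor
    · rintro ⟨⟨h1, _⟩, h3⟩
      exact ⟨h1, Nat.le_floor h3⟩
    · rintro ⟨h1, h2⟩
      have h3 : (n : ℝ) ≤ Real.exp v * Real.exp c := by
        have := Nat.floor_le hz.le
        exact le_trans (by exact_mod_cast h2) this
      refine ⟨⟨h1, ?_⟩, h3⟩
      exact_mod_cast (show (n : ℝ) ≤ N from h3.trans hN)
  rw [hfilter]
  refine Finset.sum_congr rfl fun n hn => ?_
  have hn1 : (1 : ℝ) ≤ n := by exact_mod_cast (Finset.mem_Icc.1 hn).1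
  have hle : (n : ℝ) ≤ Real.exp v * Real.exp c :=
    le_trans (by exact_mod_cast (Finset.mem_Icc.1 hn).2) (Nat.floor_le hz.le)
  have : Real.log n - c ≤ v := by
    have := Real.log_le_log (by linarith) hle
    rw [Real.log_mul (Real.exp_pos _).ne' (Real.exp_pos _).ne', Real.log_exp, Real.log_exp] at this
    linarith
  rw [indGe_apply, if_pos this]; simp

/-- The same for the reflected range `n ≤ e^{-v} e^{c}`: `n ≤ z ↔ v ≤ -(log n - c)`. [folklore] -/
theorem sum_floor_eq_sum_indLe {N : ℕ} {c v : ℝ} (hN : Real.exp (-v) * Real.exp c ≤ N)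
    (f : ℕ → ℂ) :
    ∑ n ∈ Finset.Icc 1 ⌊Real.exp (-v) * Real.exp c⌋₊, f n
      = ∑ n ∈ Finset.Icc 1 N, ((indLe (-(Real.log n - c)) v : ℝ) : ℂ) * f n := by
  rw [sum_floor_eq_sum_indGe hN f]
  refine Finset.sum_congr rfl fun n _ => ?_
  rw [indGe_apply, indLe_apply]
  congr 2
  simp only [le_neg]

set_option maxHeartbeats 800000 in
/-- **The smoothed approximate functional equation.** For `0 < κ ≤ 1/6` there are `C, t₀` such that
for all `t ≥ t₀` and all `N` with `(6/5)√(t/2π) ≤ N`,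
`‖ζ(1/2+it) - (S(t) + χ(1/2+it) conj S(t))‖ ≤ C t^{-1/4} log t`, `S(t) = ∑_{n≤N} ρ_n(t) n^{-1/2-it}`,
`ρ_n(t) = Φ̄_κ(log n - log √(t/2π))`. Proof: average
`Literature.NumberTheory.LFunctions.AFE.approxFunctionalEq_half_chi_unbalanced` at `x = e^v √(t/2π)`
(`y = e^{-v}√(t/2π)`) against `φ_κ(v) dv` on `[-κ, κ]` (`e^κ ≤ 6/5`), and use the two averaging
identities. [cite: Titchmarsh1986, Theorem 4.13] -/
theorem norm_zeta_sub_sdAFE_le {κ : ℝ} (hκ : 0 < κ) (hκ6 : κ ≤ 1 / 6) :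
    ∃ C t₀ : ℝ, ∀ t : ℝ, t₀ ≤ t → ∀ N : ℕ, 6 / 5 * Real.sqrt (t / (2 * π)) ≤ N →
      ‖riemannZeta (1 / 2 + t * I) - sdAFE κ N t‖ ≤ C * t ^ (-(1 / 4 : ℝ)) * Real.log t := by
  obtain ⟨C, t₀, hAFE⟩ := Literature.NumberTheory.LFunctions.AFE.approxFunctionalEq_half_chi_unbalanced
  refine ⟨C, max t₀ 1, fun t ht N hN => ?_⟩
  have hπ := Real.pi_pos
  have ht₀ : t₀ ≤ t := (le_max_left _ _).trans ht
  have ht1 : (1 : ℝ) ≤ t := (le_max_right _ _).trans ht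
  have ht0 : 0 < t := by linarith
  set x₀ : ℝ := Real.sqrt (t / (2 * π)) with hx₀
  have hx₀pos : 0 < x₀ := Real.sqrt_pos.2 (by positivity)
  have hx₀sq : x₀ ^ 2 = t / (2 * π) := Real.sq_sqrt (by positivity)
  set c : ℝ := Real.log x₀ with hc
  have hexpc : Real.exp c = x₀ := Real.exp_log hx₀pos
  set s : ℂ := 1 / 2 + t * I with hs
  set χ : ℂ := Literature.NumberTheory.LFunctions.riemannZetaChi s with hχ
  set ε : ℝ := C * t ^ (-(1 / 4 : ℝ)) * Real.log t with hε
  have heκ : Real.exp κ ≤ 6 / 5 :=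
    (Real.exp_le_exp.2 hκ6).trans exp_one_sixth_le
  -- the unbalanced AFE at `x = e^v x₀`, `v ∈ [-κ, κ]`
  set f1 : ℕ → ℂ := fun n => (n : ℂ) ^ (-(1 / 2 : ℂ) - t * I) with hf1
  set f2 : ℕ → ℂ := fun n => (n : ℂ) ^ (-(1 / 2 : ℂ) + t * I) with hf2
  set A : ℝ → ℂ := fun v =>
    ∑ n ∈ Finset.Icc 1 N, ((indGe (Real.log n - c) v : ℝ) : ℂ) * f1 n
      + χ * ∑ n ∈ Finset.Icc 1 N, ((indLe (-(Real.log n - c)) v : ℝ) : ℂ) * f2 n with hA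
  have hbound : ∀ v ∈ Set.Icc (-κ) κ, ‖riemannZeta s - A v‖ ≤ ε := by
    intro v hv
    have hev1 : Real.exp v ≤ 6 / 5 := (Real.exp_le_exp.2 hv.2).trans heκ
    have hev2 : 5 / 6 ≤ Real.exp v := by
      have h1 : Real.exp (-κ) ≤ Real.exp v := Real.exp_le_exp.2 hv.1
      have h2 : 5 / 6 ≤ Real.exp (-κ) := by
        rw [Real.exp_neg, le_inv_comm₀ (by norm_num) (Real.exp_pos _)]
        linarith
      linarith
    set x : ℝ := Real.exp v * x₀ with hx
    have hx1 : 5 / 6 * x₀ ≤ x := by rw [hx]; nlinarith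
    have hx2 : x ≤ 6 / 5 * x₀ := by rw [hx]; nlinarith
    have h := hAFE t ht₀ x hx1 hx2
    -- identify the two sums
    have hxN : Real.exp v * Real.exp c ≤ N := by rw [hexpc]; linarith
    have hy : t / (2 * π * x) = Real.exp (-v) * Real.exp c := by
      rw [hexpc, hx, Real.exp_neg]
      have : t = 2 * π * x₀ ^ 2 := by rw [hx₀sq]; field_simp
      rw [this]; field_simp
    have hyN : Real.exp (-v) * Real.exp c ≤ N := by
      rw [hexpc]
      have : Real.exp (-v) ≤ 6 / 5 := by
        rw [Real.exp_neg, inv_le_comm₀ (Real.exp_pos _) (by norm_num)]; linarith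
      nlinarith
    have e1 : ∑ n ∈ Finset.Icc 1 ⌊x⌋₊, (n : ℂ) ^ (-(1 / 2 : ℂ) - t * I)
        = ∑ n ∈ Finset.Icc 1 N, ((indGe (Real.log n - c) v : ℝ) : ℂ) * f1 n := by
      rw [hx, ← hexpc]; exact sum_floor_eq_sum_indGe hxN f1
    have e2 : ∑ n ∈ Finset.Icc 1 ⌊t / (2 * π * x)⌋₊, (n : ℂ) ^ (-(1 / 2 : ℂ) + t * I)
        = ∑ n ∈ Finset.Icc 1 N, ((indLe (-(Real.log n - c)) v : ℝ) : ℂ) * f2 n := by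
      rw [hy]; exact sum_floor_eq_sum_indLe hyN f2
    rw [e1, e2] at h
    simpa only [hA, sub_add_eq_sub_sub] using h
  -- integrability of `φ A` and of the pieces
  have hofR : ∀ {f : ℝ → ℝ}, IntervalIntegrable f volume (-κ) κ →
      IntervalIntegrable (fun v => (f v : ℂ)) volume (-κ) κ := fun h => ⟨h.1.ofReal, h.2.ofReal⟩
  have hintGe : ∀ n : ℕ, IntervalIntegrable (fun v => logDensity κ v * indGe (Real.log n - c) v)
      volume (-κ) κ := fun n =>
    intervalIntegrable_continuous_mul (continuous_logDensity κ) (measurable_indGe _)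
      (abs_indGe_le_one _) _ _
  have hintLe : ∀ n : ℕ, IntervalIntegrable (fun v => logDensity κ v * indLe (-(Real.log n - c)) v)
      volume (-κ) κ := fun n =>
    intervalIntegrable_continuous_mul (continuous_logDensity κ) (measurable_indLe _)
      (abs_indLe_le_one _) _ _
  have hintGeC : ∀ n : ℕ, IntervalIntegrable
      (fun v => ((logDensity κ v * indGe (Real.log n - c) v : ℝ) : ℂ) * f1 n) volume (-κ) κ :=
    fun n => (hofR (hintGe n)).mul_const _
  have hintLeC : ∀ n : ℕ, IntervalIntegrable
      (fun v => ((logDensity κ v * indLe (-(Real.log n - c)) v : ℝ) : ℂ) * f2 n) volume (-κ) κ :=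
    fun n => (hofR (hintLe n)).mul_const _
  -- `∫ φ A = sdAFE`
  have hA1 : ∀ v, ((logDensity κ v : ℝ) : ℂ) * A v
      = ∑ n ∈ Finset.Icc 1 N, ((logDensity κ v * indGe (Real.log n - c) v : ℝ) : ℂ) * f1 n
        + χ * ∑ n ∈ Finset.Icc 1 N,
            ((logDensity κ v * indLe (-(Real.log n - c)) v : ℝ) : ℂ) * f2 n := by
    intro v
    simp only [hA, mul_add, Finset.mul_sum]
    congr 1
    · refine Finset.sum_congr rfl fun n _ => ?_
      push_cast; ring
    · refine Finset.sum_congr rfl fun n _ => ?_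
      push_cast; ring
  have hsum1 : IntervalIntegrable (fun v => ∑ n ∈ Finset.Icc 1 N,
      ((logDensity κ v * indGe (Real.log n - c) v : ℝ) : ℂ) * f1 n) volume (-κ) κ := by
    have := IntervalIntegrable.sum (Finset.Icc 1 N) fun n _ => hintGeC n
    simpa only [Finset.sum_fn] using this
  have hsum2 : IntervalIntegrable (fun v => χ * ∑ n ∈ Finset.Icc 1 N,
      ((logDensity κ v * indLe (-(Real.log n - c)) v : ℝ) : ℂ) * f2 n) volume (-κ) κ := by
    have := IntervalIntegrable.sum (Finset.Icc 1 N) fun n _ => hintLeC n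
    have h' : IntervalIntegrable (fun v => ∑ n ∈ Finset.Icc 1 N,
        ((logDensity κ v * indLe (-(Real.log n - c)) v : ℝ) : ℂ) * f2 n) volume (-κ) κ := by
      simpa only [Finset.sum_fn] using this
    exact h'.const_mul _
  have hintA : IntervalIntegrable (fun v => ((logDensity κ v : ℝ) : ℂ) * A v) volume (-κ) κ := by
    simp_rw [hA1]; exact hsum1.add hsum2
  have hweight : ∀ n : ℕ, logCutoff κ (Real.log n - c) = weight κ n t := fun n => rfl
  have hIA : ∫ v in -κ..κ, ((logDensity κ v : ℝ) : ℂ) * A v = sdAFE κ N t := by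
    simp_rw [hA1]
    rw [intervalIntegral.integral_add hsum1 hsum2, intervalIntegral.integral_const_mul,
      intervalIntegral.integral_finsetSum fun n _ => hintGeC n,
      intervalIntegral.integral_finsetSum fun n _ => hintLeC n]
    have i1 : ∀ n ∈ Finset.Icc 1 N,
        ∫ v in -κ..κ, ((logDensity κ v * indGe (Real.log n - c) v : ℝ) : ℂ) * f1 n
          = (weight κ n t : ℂ) * f1 n := by
      intro n _
      rw [intervalIntegral.integral_mul_const, intervalIntegral.integral_ofReal,
        integral_logDensity_mul_indGe hκ, hweight]
    have i2 : ∀ n ∈ Finset.Icc 1 N,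
        ∫ v in -κ..κ, ((logDensity κ v * indLe (-(Real.log n - c)) v : ℝ) : ℂ) * f2 n
          = (weight κ n t : ℂ) * f2 n := by
      intro n _
      rw [intervalIntegral.integral_mul_const, intervalIntegral.integral_ofReal,
        integral_logDensity_mul_indLe hκ, hweight]
    rw [Finset.sum_congr rfl i1, Finset.sum_congr rfl i2, sdAFE_def, conj_mainSum, mainSum_def]
  -- `ζ - sdAFE = ∫ φ (ζ - A)`
  have hmass : ∫ v in -κ..κ, ((logDensity κ v : ℝ) : ℂ) = 1 := by
    rw [intervalIntegral.integral_ofReal, integral_logDensity_eq_one hκ le_rfl]; simp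
  have hintφ : IntervalIntegrable (fun v => ((logDensity κ v : ℝ) : ℂ)) volume (-κ) κ :=
    hofR ((continuous_logDensity κ).intervalIntegrable _ _)
  have hkey : riemannZeta s - sdAFE κ N t
      = ∫ v in -κ..κ, ((logDensity κ v : ℝ) : ℂ) * (riemannZeta s - A v) := by
    simp_rw [mul_sub]
    rw [intervalIntegral.integral_sub (hintφ.mul_const _) hintA, intervalIntegral.integral_mul_const,
      hmass, one_mul, hIA]
  rw [hkey]
  -- bound the integral
  have hκκ : -κ ≤ κ := by linarith
  calc ‖∫ v in -κ..κ, ((logDensity κ v : ℝ) : ℂ) * (riemannZeta s - A v)‖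
      ≤ ∫ v in -κ..κ, ‖((logDensity κ v : ℝ) : ℂ) * (riemannZeta s - A v)‖ :=
        intervalIntegral.norm_integral_le_integral_norm hκκ
    _ ≤ ∫ v in -κ..κ, logDensity κ v * ε := by
        refine intervalIntegral.integral_mono_on hκκ ?_ ?_ fun v hv => ?_
        · exact ((hintφ.mul_const (riemannZeta s)).sub hintA |>.congr
            (fun v _ => by simp only [mul_sub])).norm
        · exact ((continuous_logDensity κ).mul continuous_const).intervalIntegrable _ _
        · rw [norm_mul, Complex.norm_real, Real.norm_eq_abs, abs_of_nonneg (logDensity_nonneg hκ v)]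
          exact mul_le_mul_of_nonneg_left (hbound v hv) (logDensity_nonneg hκ v)
    _ = ε := by
        rw [intervalIntegral.integral_mul_const, integral_logDensity_eq_one hκ le_rfl, one_mul]

/-! ### Self-duality -/

/-- `‖χ(1/2+it)‖ = 1` for every real `t`: `χ(1/2+it) = e^{-2iϑ(t)}` with the (real)
Riemann–Siegel theta function of the tree
(`Literature.NumberTheory.LFunctions.riemannZetaChi_half_eq_cexp`).
[cite: Titchmarsh1986, §4.17 eq. (4.17.2)] -/
theorem norm_riemannZetaChi_half (t : ℝ) :
    ‖Literature.NumberTheory.LFunctions.riemannZetaChi (1 / 2 + t * I)‖ = 1 := by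
  rw [Literature.NumberTheory.LFunctions.riemannZetaChi_half_eq_cexp, Complex.norm_exp]
  simp

/-- **Self-duality of the smoothed main part**: if `‖χ‖ = 1` then `conj V = conj χ · V` for
`V = S + χ conj S`. [folklore] -/
theorem conj_sdAFE {κ : ℝ} {N : ℕ} {t : ℝ}
    (hχ : ‖Literature.NumberTheory.LFunctions.riemannZetaChi (1 / 2 + t * I)‖ = 1) :
    conj (sdAFE κ N t)
      = conj (Literature.NumberTheory.LFunctions.riemannZetaChi (1 / 2 + t * I)) * sdAFE κ N t := by
  set χ := Literature.NumberTheory.LFunctions.riemannZetaChi (1 / 2 + t * I) with hχdef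
  set S := mainSum κ N t with hS
  have hχχ : conj χ * χ = 1 := by
    rw [← Complex.normSq_eq_conj_mul_self, Complex.normSq_eq_norm_sq, hχ]; simp
  rw [sdAFE_def, map_add, map_mul, Complex.conj_conj, mul_add, ← mul_assoc, hχχ, one_mul, add_comm]

/-- **`‖V‖² = 2 Re(conj V · S)`** for the self-dual `V = S + χ conj S`, `‖χ‖ = 1`: indeed
`conj V · V = conj χ · V · V`… more simply `conj V · S = |S|² + conj χ · S²` and
`‖V‖² = 2|S|² + 2 Re(conj χ S²)`. [folklore] -/
theorem normSq_sdAFE {κ : ℝ} {N : ℕ} {t : ℝ}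
    (hχ : ‖Literature.NumberTheory.LFunctions.riemannZetaChi (1 / 2 + t * I)‖ = 1) :
    ‖sdAFE κ N t‖ ^ 2 = 2 * (conj (sdAFE κ N t) * mainSum κ N t).re := by
  set χ := Literature.NumberTheory.LFunctions.riemannZetaChi (1 / 2 + t * I) with hχdef
  set S := mainSum κ N t with hS
  have hV : sdAFE κ N t = S + χ * conj S := rfl
  have hχχ : conj χ * χ = 1 := by
    rw [← Complex.normSq_eq_conj_mul_self, Complex.normSq_eq_norm_sq, hχ]; simp
  -- `‖V‖² = Re(conj V · V)` and `conj V · V = conj V · S + conj (conj V · S)`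
  have h1 : (‖sdAFE κ N t‖ ^ 2 : ℝ) = (conj (sdAFE κ N t) * sdAFE κ N t).re := by
    rw [← Complex.normSq_eq_conj_mul_self, Complex.ofReal_re, Complex.normSq_eq_norm_sq]
  have hcV : conj (sdAFE κ N t) = conj S + conj χ * S := by
    rw [hV, map_add, map_mul, Complex.conj_conj]
  have h2 : conj (sdAFE κ N t) * sdAFE κ N t
      = conj (sdAFE κ N t) * S + conj (conj (sdAFE κ N t) * S) := by
    rw [hcV, hV]
    simp only [map_add, map_mul, Complex.conj_conj]
    linear_combination (S * conj S) * hχχ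
  rw [h1, h2, Complex.add_re, Complex.conj_re]
  ring


/-! ### The weights as a dilated smooth profile: `ρ_n(t) = R_κ(t/(2πn²))` -/

/-- The profile `R_κ(x) = Φ̄_κ(−½ log x)` for `x > 0`, extended by `0` near and below `0`
(where `Φ̄_κ(−½ log x) = 0` anyway, `0 < x ≤ e^{-2κ}`): a globally smooth function on `ℝ`,
`= 0` on `x ≤ e^{-2κ}`, `= 1` on `x ≥ e^{2κ}`, with `R(x) + R(1/x) = 1`. [folklore] -/
def cutoffR (κ : ℝ) (x : ℝ) : ℂ :=
  if x ≤ Real.exp (-2 * κ) / 2 then 0 else (logCutoff κ (-(1 / 2) * Real.log x) : ℂ)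

/-- Unfolding lemma. [folklore] -/
theorem cutoffR_def (κ x : ℝ) : cutoffR κ x =
    if x ≤ Real.exp (-2 * κ) / 2 then 0 else (logCutoff κ (-(1 / 2) * Real.log x) : ℂ) := rfl

/-- For `0 < x ≤ e^{-2κ}`: `Φ̄_κ(−½ log x) = 0`. [folklore] -/
theorem logCutoff_half_log_eq_zero {κ x : ℝ} (hκ : 0 < κ) (hx0 : 0 < x) (hx : x ≤ Real.exp (-2 * κ)) :
    logCutoff κ (-(1 / 2) * Real.log x) = 0 := by
  apply logCutoff_eq_zero hκ
  have := Real.log_le_log hx0 hx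
  rw [Real.log_exp] at this
  linarith

/-- For `x > 0`: `R_κ(x) = Φ̄_κ(−½ log x)`. [folklore] -/
theorem cutoffR_eq_of_pos {κ x : ℝ} (hκ : 0 < κ) (hx : 0 < x) :
    cutoffR κ x = (logCutoff κ (-(1 / 2) * Real.log x) : ℂ) := by
  rw [cutoffR_def]
  split_ifs with h
  · rw [logCutoff_half_log_eq_zero hκ hx (by linarith [Real.exp_pos (-2 * κ)])]; simp
  · rfl

/-- `R_κ = 0` on `x ≤ e^{-2κ}`. [folklore] -/
theorem cutoffR_eq_zero {κ x : ℝ} (hκ : 0 < κ) (hx : x ≤ Real.exp (-2 * κ)) : cutoffR κ x = 0 := by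
  rw [cutoffR_def]
  split_ifs with h
  · rfl
  · have hx0 : 0 < x := by linarith [Real.exp_pos (-2 * κ), not_le.1 h]
    rw [logCutoff_half_log_eq_zero hκ hx0 hx]; simp

/-- `R_κ = 1` on `x ≥ e^{2κ}`. [folklore] -/
theorem cutoffR_eq_one {κ x : ℝ} (hκ : 0 < κ) (hx : Real.exp (2 * κ) ≤ x) : cutoffR κ x = 1 := by
  have hx0 : 0 < x := lt_of_lt_of_le (Real.exp_pos _) hx
  rw [cutoffR_eq_of_pos hκ hx0, logCutoff_eq_one hκ]
  · simp
  · have := Real.log_le_log (Real.exp_pos _) hx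
    rw [Real.log_exp] at this
    linarith

/-- `‖R_κ‖ ≤ 1`. [folklore] -/
theorem norm_cutoffR_le_one (κ x : ℝ) : ‖cutoffR κ x‖ ≤ 1 := by
  rw [cutoffR_def]
  split_ifs
  · simp
  · rw [Complex.norm_real, Real.norm_eq_abs, abs_of_nonneg (logCutoff_nonneg _ _)]
    exact logCutoff_le_one _ _

/-- `R_κ` is smooth (`κ > 0`). [folklore] -/
theorem contDiff_cutoffR {κ : ℝ} (hκ : 0 < κ) {n : ℕ∞} : ContDiff ℝ n (cutoffR κ) := by
  have he : 0 < Real.exp (-2 * κ) := Real.exp_pos _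
  -- the smooth branch
  have hsmooth : ∀ x, Real.exp (-2 * κ) / 2 < x →
      ContDiffAt ℝ n (fun y => ((logCutoff κ (-(1 / 2) * Real.log y) : ℝ) : ℂ)) x := by
    intro x hx
    have hx0 : x ≠ 0 := by linarith
    have h1 : ContDiffAt ℝ n (fun y => -(1 / 2) * Real.log y) x :=
      contDiffAt_const.mul (Real.contDiffAt_log.2 hx0)
    have h2 : ContDiffAt ℝ n (fun y => logCutoff κ (-(1 / 2) * Real.log y)) x :=
      (contDiff_logCutoff κ).contDiffAt.comp x h1
    exact Complex.ofRealCLM.contDiff.contDiffAt.comp x h2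
  refine contDiff_iff_contDiffAt.2 fun x => ?_
  rcases lt_or_ge x (Real.exp (-2 * κ)) with hx | hx
  · -- near `x`, `R = 0`
    have hev : cutoffR κ =ᶠ[𝓝 x] fun _ => (0 : ℂ) := by
      filter_upwards [Iio_mem_nhds hx] with y hy
      exact cutoffR_eq_zero hκ (le_of_lt hy)
    exact (contDiffAt_const (c := (0 : ℂ))).congr_of_eventuallyEq hev
  · -- near `x`, `R = Φ̄(−½ log ·)`
    have hx1 : Real.exp (-2 * κ) / 2 < x := by linarith
    have hev : cutoffR κ =ᶠ[𝓝 x] fun y => ((logCutoff κ (-(1 / 2) * Real.log y) : ℝ) : ℂ) := by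
      filter_upwards [Ioi_mem_nhds hx1] with y hy
      rw [cutoffR_def, if_neg (not_le.2 hy)]
    exact (hsmooth x hx1).congr_of_eventuallyEq hev

/-- `R_κ` is continuous (`κ > 0`). [folklore] -/
theorem continuous_cutoffR {κ : ℝ} (hκ : 0 < κ) : Continuous (cutoffR κ) :=
  (contDiff_cutoffR hκ (n := 0)).continuous

/-- For `j ≥ 1`, `R_κ^{(j)}` vanishes off `[e^{-2κ}, e^{2κ}]` (`κ > 0`). [folklore] -/
theorem iteratedDeriv_cutoffR_eq_zero {κ : ℝ} (hκ : 0 < κ) {j : ℕ} (hj : j ≠ 0) {x : ℝ}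
    (hx : x < Real.exp (-2 * κ) ∨ Real.exp (2 * κ) < x) : iteratedDeriv j (cutoffR κ) x = 0 := by
  rcases hx with hx | hx
  · have h : Set.EqOn (cutoffR κ) (fun _ => (0 : ℂ)) (Set.Iio (Real.exp (-2 * κ))) :=
      fun y hy => cutoffR_eq_zero hκ (le_of_lt hy)
    rw [h.iteratedDeriv_of_isOpen isOpen_Iio j hx, iteratedDeriv_const, if_neg hj]
  · have h : Set.EqOn (cutoffR κ) (fun _ => (1 : ℂ)) (Set.Ioi (Real.exp (2 * κ))) :=
      fun y hy => cutoffR_eq_one hκ (le_of_lt hy)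
    rw [h.iteratedDeriv_of_isOpen isOpen_Ioi j hx, iteratedDeriv_const, if_neg hj]

/-- Each derivative of `R_κ` is bounded (`κ > 0`). [folklore] -/
theorem exists_bound_iteratedDeriv_cutoffR {κ : ℝ} (hκ : 0 < κ) (j : ℕ) :
    ∃ B : ℝ, 0 ≤ B ∧ ∀ x, ‖iteratedDeriv j (cutoffR κ) x‖ ≤ B := by
  rcases Nat.eq_zero_or_pos j with rfl | hj
  · exact ⟨1, zero_le_one, fun x => by rw [iteratedDeriv_zero]; exact norm_cutoffR_le_one κ x⟩
  · have hcont : Continuous (iteratedDeriv j (cutoffR κ)) :=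
      (contDiff_cutoffR hκ).continuous_iteratedDeriv j (by exact_mod_cast le_top)
    have hsupp : HasCompactSupport (iteratedDeriv j (cutoffR κ)) := by
      refine HasCompactSupport.of_support_subset_isCompact (isCompact_Icc (a := Real.exp (-2 * κ))
        (b := Real.exp (2 * κ))) fun x hx => ?_
      rw [Function.mem_support] at hx
      by_contra h
      rw [Set.mem_Icc, not_and_or, not_le, not_le] at h
      exact hx (iteratedDeriv_cutoffR_eq_zero hκ hj.ne' h)
    obtain ⟨C, hC⟩ := hcont.bounded_above_of_compact_support hsupp
    exact ⟨max C 0, le_max_right _ _, fun x => (hC x).trans (le_max_left _ _)⟩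

/-- **`ρ_n(t) = R_κ(t/(2πn²))`** for `t > 0`, `n ≥ 1`. [folklore] -/
theorem weight_eq_cutoffR {κ : ℝ} (hκ : 0 < κ) {n : ℕ} (hn : 1 ≤ n) {t : ℝ} (ht : 0 < t) :
    (weight κ n t : ℂ) = cutoffR κ ((2 * π * (n : ℝ) ^ 2)⁻¹ * t) := by
  have hπ := Real.pi_pos
  have hn0 : (0 : ℝ) < n := by exact_mod_cast hn
  have hc : 0 < 2 * π * (n : ℝ) ^ 2 := by positivity
  have hx : 0 < (2 * π * (n : ℝ) ^ 2)⁻¹ * t := by positivity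
  rw [cutoffR_eq_of_pos hκ hx, weight_def]
  congr 2
  rw [Real.log_sqrt (by positivity), Real.log_mul (inv_ne_zero hc.ne') ht.ne', Real.log_inv,
    Real.log_mul (by positivity) (by positivity), Real.log_pow, Real.log_div ht.ne' (by positivity)]
  ring

/-- **Derivative bounds for the dilated profile**: for `κ > 0` and `j` there is `B ≥ 0` such that
`‖(d/dt)^j R_κ(t/(2πn²))‖ ≤ B / T^j` for all `n ≥ 1`, `T > 0` and `t ≥ T` (the derivative being
supported where `t/(2πn²) ∈ [e^{-2κ}, e^{2κ}]`, i.e. `2πn² ≥ e^{-2κ} t`). [folklore] -/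
theorem norm_iteratedDeriv_weightProfile_le {κ : ℝ} (hκ : 0 < κ) (j : ℕ) :
    ∃ B : ℝ, 0 ≤ B ∧ ∀ n : ℕ, 1 ≤ n → ∀ T : ℝ, 0 < T → ∀ t : ℝ, T ≤ t →
      ‖iteratedDeriv j (fun u => cutoffR κ ((2 * π * (n : ℝ) ^ 2)⁻¹ * u)) t‖ ≤ B / T ^ j := by
  obtain ⟨B₀, hB₀, hB⟩ := exists_bound_iteratedDeriv_cutoffR hκ j
  refine ⟨B₀ * Real.exp (2 * κ) ^ j, by positivity, fun n hn T hT t ht => ?_⟩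
  have hπ := Real.pi_pos
  have hn0 : (0 : ℝ) < n := by exact_mod_cast hn
  set c : ℝ := (2 * π * (n : ℝ) ^ 2)⁻¹ with hc
  have hcpos : 0 < c := by rw [hc]; positivity
  have hcd := contDiff_infty.mp (contDiff_cutoffR hκ (n := ⊤)) j
  rw [congrFun (iteratedDeriv_comp_const_smul hcd c) t, norm_smul, norm_pow, Real.norm_eq_abs,
    abs_of_pos hcpos]
  rcases Nat.eq_zero_or_pos j with rfl | hj
  · simp only [pow_zero, one_mul, div_one]
    exact (hB _).trans (by simp)
  · by_cases hzero : iteratedDeriv j (cutoffR κ) (c * t) = 0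
    · rw [hzero, norm_zero, mul_zero]; positivity
    · -- then `c t ∈ [e^{-2κ}, e^{2κ}]`, so `c ≤ e^{2κ}/t ≤ e^{2κ}/T`
      have hmem : Real.exp (-2 * κ) ≤ c * t ∧ c * t ≤ Real.exp (2 * κ) := by
        by_contra h
        rw [not_and_or, not_le, not_le] at h
        exact hzero (iteratedDeriv_cutoffR_eq_zero hκ hj.ne' h)
      have hct : c ≤ Real.exp (2 * κ) / T := by
        rw [le_div_iff₀ hT]
        calc c * T ≤ c * t := mul_le_mul_of_nonneg_left ht hcpos.le
          _ ≤ Real.exp (2 * κ) := hmem.2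
      have hcj : c ^ j ≤ Real.exp (2 * κ) ^ j / T ^ j := by
        rw [← div_pow]; exact pow_le_pow_left₀ hcpos.le hct j
      calc c ^ j * ‖iteratedDeriv j (cutoffR κ) (c * t)‖ ≤ (Real.exp (2 * κ) ^ j / T ^ j) * B₀ :=
            mul_le_mul hcj (hB _) (norm_nonneg _) (by positivity)
        _ = B₀ * Real.exp (2 * κ) ^ j / T ^ j := by ring

/-- The dilated profile is smooth. [folklore] -/
theorem contDiff_weightProfile {κ : ℝ} (hκ : 0 < κ) (n : ℕ) {m : ℕ∞} :
    ContDiff ℝ m (fun u => cutoffR κ ((2 * π * (n : ℝ) ^ 2)⁻¹ * u)) :=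
  (contDiff_cutoffR hκ).comp (contDiff_const.mul contDiff_id)

end Literature.NumberTheory.LFunctions.SelfDualAFE
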